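import Mathlib
import HarnessLib
import Literature.Computability.Complexity.KWProtocol
import Literature.Computability.Complexity.KRWComposition
import Literature.Computability.Complexity.Circuit
import Literature.Computability.Complexity.CircuitComposition
import Literature.Computability.Complexity.CircuitRestriction
import Literature.Computability.Complexity.NegationElimination
import Literature.Computability.Complexity.ConstantDepth

/-!
# Karchmer–Wigderson, easy direction, for the tree's straight-line `B₂`-circuits

Support file for item stmt-PneNP-18541 (`CompositionIteration`, route `KrwChromaticSteering`):
the registered stub `stub_kw` of the birth skeleton
(`Cruxes/CompositionIteration/Lines/birth.lean`), proved with the constant `c₁ = 3`.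

**Statement.** For every circuit `C` over the full binary basis `B₂` on `n ≥ 1` variables computing
`h`, there is a protocol tree (`KWTree`) solving the Karchmer–Wigderson game of `h` of depth
`≤ 3 · acDepth C` (`acDepth`: negation gates weigh `0`, every other gate `1`).

**Proof** (Karchmer–Wigderson 1990; Jukna 2012, Thm. 3.13 / Claim 3.14, adapted to arbitrary gates of
fan-in `≤ 2`). Induction along the gate list, producing for every wire `u` a protocol for the
function carried by `u` of depth `≤ 3 ·` (weighted depth of `u`):
* an input wire `x_i` is solved by the leaf `i` (depth `0`);
* a negation gate is a ROLE SWAP of the protocol of its argument (`KWTree.swap`, same depth — and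
  `acWeight ¬ = 0`);
* any other gate `v = op(u_1, …, u_k)`, `k ≤ 2`: Alice announces the values of the `k` argument wires
  on her input (2 rounds, `aliceChoose`), Bob — whose argument values must differ somewhere, since
  `op` of them differs — names such a position `a` (1 round, `bobChoose`), and the players continue
  with the protocol of `u_a`, swapped if Alice's value there is `0`; cost `3 +` the deepest argument.
Nothing here bears on P vs NP (it is the printed simulation of formulas/circuits by protocols).
-/

set_option linter.dupNamespace false -- `Summit.PneNP.PneNP.…`: summit = sub-problem name (D-0017 single-conjunct layout)

namespace Summit.PneNP.PneNP.Theorems.KrwCompositionIteration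

open Literature.Computability.Complexity
open Literature.Computability.Complexity.GateList
open Finset

universe u

variable {ι : Type u}

/-- A protocol solving the KW game of `f` solves that of any function equal to `f` pointwise. -/
theorem solves_congr {P : KWTree ι} {f g : (ι → Bool) → Bool} (h : P.Solves f)
    (hfg : ∀ x, f x = g x) : P.Solves g :=
  fun a b ha hb => h a b (by rw [hfg]; exact ha) (by rw [hfg]; exact hb)

/-- Negation is free: the role swap of a protocol for `KW_f` solves `KW_{¬f}`. -/
theorem solves_swap_not {P : KWTree ι} {f : (ι → Bool) → Bool} (h : P.Solves f) :
    P.swap.Solves (fun x => !f x) := by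
  intro a b ha hb
  rw [KWTree.run_swap]
  have hfa : f a = false := by simpa using ha
  have hfb : f b = true := by simpa using hb
  exact fun hab => h b a hfb hfa hab.symm

/-- The leaf `i` solves the KW game of the projection `x ↦ x i`. -/
theorem solves_leaf (i : ι) : (KWTree.leaf i).Solves (fun x => x i) := by
  intro a b ha hb
  dsimp only at ha hb
  rw [KWTree.run_leaf, ha, hb]
  decide

/-- **One gate of fan-in `≤ 2`.** If every argument wire `a` of a gate `op(u_1,…,u_k)` (`k ≤ 2`)
has a protocol of depth `≤ D`, the gate has one of depth `≤ D + 3`: Alice announces her `k`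
argument values (encoded by `Fintype.equivFin`, `< 2^k ≤ 4`, two rounds), Bob names an argument
where his value differs (one round), and they run that argument's protocol, swapped if Alice's
value there is `0`. `i₀` is only used to fill unreachable continuations. -/
theorem exists_solves_gate (i₀ : ι) {k : ℕ} (hk : k ≤ 2) (op : (Fin k → Bool) → Bool)
    (W : (ι → Bool) → Fin k → Bool) (D : ℕ)
    (hP : ∀ a : Fin k, ∃ P : KWTree ι, P.Solves (fun x => W x a) ∧ P.depth ≤ D) :
    ∃ P : KWTree ι, P.Solves (fun x => op (W x)) ∧ P.depth ≤ D + 3 := by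
  classical
  choose P hPs hPd using hP
  -- encode assignments `Fin k → Bool` by numbers `< 2 ^ k ≤ 4`
  let e : (Fin k → Bool) ≃ Fin (Fintype.card (Fin k → Bool)) := Fintype.equivFin _
  have hcard : Fintype.card (Fin k → Bool) ≤ 2 ^ 2 := by
    rw [Fintype.card_fun, Fintype.card_bool, Fintype.card_fin]
    exact Nat.pow_le_pow_right (by norm_num) hk
  let dec : ℕ → (Fin k → Bool) := fun v =>
    if h : v < Fintype.card (Fin k → Bool) then e.symm ⟨v, h⟩ else fun _ => false
  have hdec : ∀ w, dec (e w).val = w := by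
    intro w
    simp only [dec, dif_pos (e w).isLt, Fin.eta, Equiv.symm_apply_apply]
  -- Bob's index: an argument where his value differs from the announced assignment
  let idx : ℕ → (ι → Bool) → ℕ := fun v y =>
    if h : ∃ a : Fin k, W y a ≠ dec v a then (Classical.choose h).val else 0
  -- the continuation after both announcements
  let Q : ℕ → ℕ → KWTree ι := fun v j =>
    if h : j < k then (if dec v ⟨j, h⟩ = true then P ⟨j, h⟩ else (P ⟨j, h⟩).swap)
    else KWTree.leaf i₀
  refine ⟨KWTree.aliceChoose 2 (fun x => (e (W x)).val) fun v => KWTree.bobChoose 1 (idx v) (Q v),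
    ?_, ?_⟩
  · -- correctness
    intro x y hx hy
    dsimp only at hx hy
    have hcode : (e (W x)).val < 2 ^ 2 := lt_of_lt_of_le (e (W x)).isLt hcard
    rw [KWTree.run_aliceChoose 2 _ _ x y hcode]
    -- Bob's argument values differ from Alice's somewhere
    have hne : ∃ a : Fin k, W y a ≠ dec (e (W x)).val a := by
      rw [hdec]
      by_contra hall
      have hWW : W y = W x := funext fun a => by
        by_contra h
        exact hall ⟨a, h⟩
      rw [hWW, hx] at hy
      exact Bool.noConfusion hy
    have key : ∀ a : Fin k, W y a ≠ dec (e (W x)).val a → W y a ≠ W x a := fun a h => by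
      rwa [hdec] at h
    obtain ⟨a, ha_def⟩ : ∃ a : Fin k, Classical.choose hne = a := ⟨_, rfl⟩
    have ha : W y a ≠ W x a := by
      have h1 := key _ (Classical.choose_spec hne)
      rwa [ha_def] at h1
    have hidx : idx (e (W x)).val y = a.val := by
      simp only [idx, dif_pos hne, ha_def]
    have hlt : idx (e (W x)).val y < 2 ^ 1 := by
      rw [hidx]
      have := a.isLt
      omega
    rw [KWTree.run_bobChoose 1 _ _ x y hlt, hidx]
    simp only [Q, dif_pos a.isLt, Fin.eta, hdec]
    by_cases hxa : W x a = true
    · rw [if_pos hxa]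
      have hya : W y a = false := by simpa [hxa] using ha
      exact hPs a x y hxa hya
    · rw [if_neg hxa]
      have hxa' : W x a = false := by simpa using hxa
      have hya : W y a = true := by simpa [hxa'] using ha
      rw [KWTree.run_swap]
      exact fun hxy => hPs a y x hya hxa' hxy.symm
  · -- depth: `2` (Alice) `+ 1` (Bob) `+ D` (the argument protocol)
    refine (KWTree.depth_aliceChoose_le 2 _ _ (1 + D) fun v _ => ?_).trans (by omega)
    refine KWTree.depth_bobChoose_le 1 _ _ D fun j _ => ?_
    simp only [Q]
    split
    · split
      · exact hPd _
      · rw [KWTree.depth_swap]; exact hPd _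
    · simp

/-- **Every wire of a well-formed straight-line program with gates of fan-in `≤ 2` has a protocol
of depth at most `3 ×` its `acWeight`-depth** (induction along the program; `i₀` fills
unreachable continuations). -/
theorem exists_solves_wire (i₀ : ι) :
    ∀ (gs : List (Gate ι)), WF gs → (∀ g ∈ gs, g.arity ≤ 2) →
      ∀ u : ι ⊕ ℕ, OutOK gs.length u →
        ∃ P : KWTree ι, P.Solves (fun x => wireOf x (vals gs x) u) ∧
          P.depth ≤ 3 * wireDepthOf (wdepths acWeight gs) u := by
  intro gs
  induction gs using List.reverseRecOn with
  | nil =>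
    intro _ _ u hu
    cases u with
    | inl i => exact ⟨KWTree.leaf i, solves_leaf i, by simp⟩
    | inr m => exact absurd (hu m rfl) (by simp)
  | append_singleton pre g ih =>
    intro hwf har u hu
    have hwf' : WF pre := hwf.of_append_left
    have har' : ∀ g' ∈ pre, g'.arity ≤ 2 := fun g' hg' => har g' (List.mem_append_left _ hg')
    have hg2 : g.arity ≤ 2 := har g (by simp)
    have hgOK : GateOK pre.length g := hwf.getLast
    cases u with
    | inl i => exact ⟨KWTree.leaf i, solves_leaf i, by simp⟩
    | inr m =>
      have hm : m < pre.length + 1 := by simpa using hu m rfl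
      by_cases hlt : m < pre.length
      · -- an earlier gate: value and depth are unchanged by appending `g`
        have hOK : OutOK pre.length (.inr m : ι ⊕ ℕ) := fun m' hm' => by cases hm'; exact hlt
        obtain ⟨P, hP, hd⟩ := ih hwf' har' (.inr m) hOK
        refine ⟨P, solves_congr hP fun x => ?_, ?_⟩
        · exact (wireOf_vals_append pre [g] x (.inr m) hOK).symm
        · rwa [wireDepthOf_wdepths_append acWeight pre [g] (.inr m) hOK]
      · -- the new gate
        have hme : m = pre.length := by omega
        subst hme
        have hval : ∀ x, wireOf x (vals (pre ++ [g]) x) (.inr pre.length) =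
            g.op (fun a => wireOf x (vals pre x) (g.args a)) := fun x => by
          rw [wireOf_inr]; exact getD_vals_append_cons pre g [] x
        have hdep : wireDepthOf (wdepths acWeight (pre ++ [g])) (.inr pre.length : ι ⊕ ℕ) =
            acWeight g.fn + univ.sup fun a => wireDepthOf (wdepths acWeight pre) (g.args a) := by
          rw [wireDepthOf_inr]; exact getD_wdepths_append_singleton acWeight pre g
        by_cases hnot : g.fn = GateFn.not
        · -- a negation gate: role swap, no extra round (`acWeight ¬ = 0`)
          obtain ⟨w, rfl⟩ := exists_eq_notGate_of_fn_eq hnot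
          obtain ⟨P, hP, hd⟩ := ih hwf' har' w (fun m' hm' => hgOK ⟨0, Nat.one_pos⟩ m' hm')
          refine ⟨P.swap, solves_congr (solves_swap_not hP) fun x => ?_, ?_⟩
          · rw [hval]; rfl
          · rw [KWTree.depth_swap, hdep, notGate_fn, acWeight_not, zero_add]
            refine hd.trans (Nat.mul_le_mul_left 3 ?_)
            exact Finset.le_sup (f := fun a : Fin (notGate w).arity =>
              wireDepthOf (wdepths acWeight pre) ((notGate w).args a))
              (b := ⟨0, Nat.one_pos⟩) (Finset.mem_univ _)
        · -- any other gate of fan-in `≤ 2`: three extra rounds (`acWeight = 1`)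
          have hw1 : acWeight g.fn = 1 := by simp [acWeight, hnot]
          have hargs : ∀ a : Fin g.arity, ∃ P : KWTree ι,
              P.Solves (fun x => wireOf x (vals pre x) (g.args a)) ∧
                P.depth ≤ 3 * univ.sup (fun a => wireDepthOf (wdepths acWeight pre) (g.args a)) := by
            intro a
            obtain ⟨P, hP, hd⟩ := ih hwf' har' (g.args a) (fun m' hm' => hgOK a m' hm')
            exact ⟨P, hP, hd.trans (Nat.mul_le_mul_left 3 (Finset.le_sup
              (f := fun a => wireDepthOf (wdepths acWeight pre) (g.args a)) (Finset.mem_univ a)))⟩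
          obtain ⟨P, hP, hd⟩ := exists_solves_gate i₀ hg2 g.op
            (fun x a => wireOf x (vals pre x) (g.args a)) _ hargs
          refine ⟨P, solves_congr hP fun x => (hval x).symm, ?_⟩
          rw [hdep, hw1]
          omega

/-- **Karchmer–Wigderson, circuit ⟹ protocol** (`B₂` straight-line circuits, general game): a
circuit over `B₂` on `n ≥ 1` variables computing `h` yields a protocol tree solving `KW_h` of
depth `≤ 3 · acDepth C`. -/
theorem exists_solves_of_computes {n : ℕ} (hn : 1 ≤ n) (C : Circuit (Fin n))
    (h : (Fin n → Bool) → Bool) (hB : C.IsOver B2) (hC : C.Computes h) :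
    ∃ P : KWTree (Fin n), P.Solves h ∧ P.depth ≤ 3 * C.acDepth := by
  have har : ∀ g ∈ C.gates, g.arity ≤ 2 := fun g hg => hB g hg
  obtain ⟨P, hP, hd⟩ :=
    exists_solves_wire (⟨0, hn⟩ : Fin n) C.gates (wf_gates C) har C.output C.wf_output
  refine ⟨P, solves_congr hP fun x => ?_, ?_⟩
  · rw [← hC x, circuit_eval]
  · rwa [Circuit.acDepth, circuit_depthWith]

/-- The registered stub `stub_kw` of the birth skeleton (verbatim signature), with `c₁ = 3`: there
is `c₁` such that every `B₂`-circuit on `n ≥ 1` variables computing `h` gives a protocol for `KW_h`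
of depth `≤ c₁ · acDepth`. -/
theorem stub_kw : ∃ c₁ : ℕ, ∀ n : ℕ, 1 ≤ n → ∀ (C : Circuit (Fin n)) (h : (Fin n → Bool) → Bool), C.IsOver B2 → C.Computes h → ∃ P : KWTree (Fin n), P.Solves h ∧ P.depth ≤ c₁ * C.acDepth :=
  ⟨3, fun _ hn C h hB hC => exists_solves_of_computes hn C h hB hC⟩

end Summit.PneNP.PneNP.Theorems.KrwCompositionIteration
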